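import Literature.MathematicalPhysics.QuantumFieldTheory.Balaban1983to89.B6MultiLevelTorusMirrorBlockLetter
import Literature.MathematicalPhysics.QuantumFieldTheory.Balaban1983to89.B9Cor35GpDirInputsAtOne
import Literature.MathematicalPhysics.QuantumFieldTheory.Balaban1983to89.B9Eq3105DirichletBondLettersAtOneY

/-!
# `Balaban1983to89.B9CubeDirichletCLetterAtOne` — [Balaban1985BackgroundPropagators] Theorem 3.2 (3.48) p. 398 AT `U = 1` FOR PRINT's DIRICHLET
# `C_□(1) = (Q′_□G′_□(1)²Q′*_□)⁻¹` ON THE BLOCKS INSIDE `Ω₀(□)` (p. 409 l. 1–5), BY THE METHOD OF IMAGES AT BLOCK LEVEL ([Balaban1983RegularityDecay] (2.42) p. 584):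
# the CUBE INSTANCE of the fold engine — n06-j's socket `hKX` DISCHARGED with an explicit `K_X` (ROAD (I) «IMAGES», file D3g∕5b-iiB-β; seat dag-n06-c g33)

statement-level skeleton of published theorems with citation tags; proofs where landed; nothing here is a claim about the Yang–Mills mass gap

## What this file does (mathematically)

[Balaban1985BackgroundPropagators] p. 409 l. 1–5 reads the third cube letter at `U = 1` as `C_□(1) := (Q′_□G′_□(1)²Q′*_□)⁻¹`, `G′_□(1)` the
Dirichlet Green's function of `Ω₀(□)` (p. 394), inverted on the unit-lattice blocks INSIDE `Ω₀(□)`; Theorem 3.2 (3.48) p. 398 asks for its decay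
`|C_□(1)(y, y′)| ≤ C·(L^jη)^{−4}·e^{−δ d_j(y,y′)}`, print: «can be proved exactly in the same way» as [Balaban1984PropagatorsII] Prop. 2.3.  n06-j's
`B9Eq3105DirichletBondLettersAtOneY.XinvCubeDY_parKnitCubeY_GpDirY_one` DISPLAYS the inverse as a socket
`hKX : (xDirMatY i □ Ω₀(□) G′_□(1))|_𝔖 · K_X|_𝔖 = 1`, `𝔖 := insideBlkY i □ Ω₀(□)`.  This file DISCHARGES that socket by the method of images
([Balaban1983RegularityDecay] (2.42) p. 584) lifted to blocks (FILES `B6MultiLevelTorusMirrorBlockTiling ∕ …BlockLetter`):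
* §1 the two MARGINS of the cube: a block of the reflected cube family `F′_□` meeting the open box lies in it (g31 `margC`), and a block of the cube
  family `F_□` meeting `Ω₀(□)` lies in it (`mem_dirDomC_of_lev_pos`; level-0 blocks are sites);
* §2 the block correspondence `𝔖 ≃ blkInside F′_□ (open box)`, `s ↦ ŝ` (`hatB`), with `y′(ŷ) = ŝ ↔ y(emb ŷ) = s` and equal levels;
* §3 the three entry identifications on the open box: `fold(Q′[F′])(ŝ, x̂) = q′_□(s, emb x̂)`, `fold(Ĝ)(x̂, ẑ) = G′_□(1)(emb x̂, emb ẑ)` (g31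
  `GpDirOne_apply_of_mem`), `fold_blk(Q′*[F′])(ŷ, ŝ′) = q′*_□(emb ŷ, s′)` (site ∕ block freeness kill the non-trivial images);
* §4 ★★ `xDirMatY i □ Ω₀(□) G′_□(1) (s, s″) = fold_blk(X̂)(ŝ, ŝ″)` on `𝔖` (FILE …BlockLetter `fold_xHat_eq_prod` + the bijection `emb : box ≃ Ω₀(□)`),
  the explicit `K_X := kxDirY i □` (`= fold_blk(Ĉ)(ŝ, ŝ′)` on `𝔖 × 𝔖`, `0` elsewhere; `Ĉ = (Q′[F′]Ĝ²Q′*[F′])⁻¹` the genuine torus inverse), and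
  ★★★ `hKX_dirDomY` : `(xDirMatY …)|_𝔖 · (kxDirY i □)|_𝔖 = 1` (FILE …BlockLetter `compress_fold_xHat_mul_compress_fold_cHat`).
The (3.48) DECAY of `kxDirY` (from `prop23_multiLevelTorus` at `F′_□` and g31's `dist_blkPsi_le_dist_trefl`) is the sequel's.

## Status

Printed-statement pass + proof body (proof-backed; a port in the tree's vocabulary): [Balaban1985BackgroundPropagators] pp. 394, 398, 408–409 and
[Balaban1983RegularityDecay] §2 (2.42) p. 584 (held: `papers/balaban1983regularitydecay.pdf`), [Balaban1984PropagatorsII] (2.17) p. 225, Prop. 2.3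
p. 238, re-read 2026-08-31.  Honest label: the COMPRESSED INVERSE of the U = 1 Dirichlet block word is now an EXPLICIT signed block-image sum of a torus
inverse — an exact identity, no estimate yet; Theorem 3.2 for the Dirichlet letter follows in the sequel from Prop. 2.3 on the reflected torus.  Node
N06 of the `pub-ymgap` DAG is NOT discharged here and the Yang–Mills mass gap is NOT proved here.  NEW file; nothing landed is modified.  No `sorry`,
no `axiom`, no `instance`, no `notation`.  Net new unproved facts: 0.  Cell `pub-ymgap` (HUMAN RULING D-0062), node N06 [B9], seat
`pub-ymgap-dag-n06-c` (g33), 2026-08-31.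
RELATED, NOT DUPLICATED (searched 2026-08-31: `rg 'hatB|kxDirY|hKX_dirDomY|xDirMatY_apply_inside|blkOf_mem_insideBlkY'` over `Literature ∕ Summits` = ∅):
g31 `B9CubeDirichletLetterAtOne` (the SITE-level images for `G′_□(1)` — consumed: `GpDirOne_apply_of_mem`, `blkOf_eq_iff_blkOf_emb_eq`), n06-j
`B9Eq3105DirichletBondLettersAtOneY` (the socket's owner), UNIT 1 `B9Cor35GpDirInputsAtOne` (`dirDomY`, `GpDirOneY`, `compr_GpDirOneY`).
-/

namespace Literature.MathematicalPhysics.QuantumFieldTheory.Balaban1983to89.B9CubeDirichletCLetterAtOne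

noncomputable section

open Finset Matrix
open Literature.MathematicalPhysics.QuantumFieldTheory.Balaban1983to89.B4Reflection242 (boxDom mem_boxDom blk)
open Literature.MathematicalPhysics.QuantumFieldTheory.Balaban1983to89.B6MultiLevelBoxOperator (N0)
open Literature.MathematicalPhysics.QuantumFieldTheory.Balaban1983to89.B6MultiLevelTorusOperator (gmlT)
open Literature.MathematicalPhysics.QuantumFieldTheory.Balaban1983to89.B6MultiLevelTorusOperatorL0 (TDomains)
open Literature.MathematicalPhysics.QuantumFieldTheory.Balaban1983to89.B6Geom246MultiLevelBoxL0 (bset blkOf blkOf_val exists_blkOf_eq blkOf_eq_iff_blk lev_eq_of_blkOf_eq)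
open Literature.MathematicalPhysics.QuantumFieldTheory.Balaban1983to89.B6Cover236MultiLevelBlocks (cubes)
open Literature.MathematicalPhysics.QuantumFieldTheory.Balaban1983to89.B6Ineq268MultiLevelBoxL0 (W W_eq)
open Literature.MathematicalPhysics.QuantumFieldTheory.Balaban1983to89.B6Ineq288MultiLevelTorusL0 (QM QsM)
open Literature.MathematicalPhysics.QuantumFieldTheory.Balaban1983to89.B4Eq242TorusMirrors
open Literature.MathematicalPhysics.QuantumFieldTheory.Balaban1983to89.B4Eq242SignedImagesFold (foldK foldK_apply)
open Literature.MathematicalPhysics.QuantumFieldTheory.Balaban1983to89.B6MultiLevelTorusMirrorL0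
open Literature.MathematicalPhysics.QuantumFieldTheory.Balaban1983to89.B6MultiLevelTorusMirrorCompression (mirBoxOpen_subset_closed)
open Literature.MathematicalPhysics.QuantumFieldTheory.Balaban1983to89.B9CubeSequence408 (cubeFam)
open Literature.MathematicalPhysics.QuantumFieldTheory.Balaban1983to89.B9CubeSequence408Mirrors
open Literature.MathematicalPhysics.QuantumFieldTheory.Balaban1983to89.B9CubeDirichletLetterAtOne (GpDirOne GpDirOne_apply_of_mem GpDirOne_apply_of_not_mem_left
  GpDirOne_apply_of_not_mem_right)
open Literature.MathematicalPhysics.QuantumFieldTheory.Balaban1983to89.B6MultiLevelTorusMirrorMajorant (blkOf_eq_iff_blkOf_emb_eq)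
open Literature.MathematicalPhysics.QuantumFieldTheory.Balaban1983to89.B9Thm31CubeLocalFlat (wCube wCube_pos wCube_window)
open Literature.MathematicalPhysics.QuantumFieldTheory.Balaban1983to89.B6KLevelCensusIndexV1 (KIdx)
open Literature.MathematicalPhysics.QuantumFieldTheory.Balaban1983to89.B9CubeLettersOpsL0 (cubeFamY oddMh)
open Literature.MathematicalPhysics.QuantumFieldTheory.Balaban1983to89.B9CubeLettersBondOpsL0 (BlkCubeY qpKc qpsKc)
open Literature.MathematicalPhysics.QuantumFieldTheory.Balaban1983to89.B9Cor35GpDirInputsAtOne (dirDomY GpDirOneY compr_GpDirOneY)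
open Literature.MathematicalPhysics.QuantumFieldTheory.Balaban1983to89.B9Eq3105DirichletBondLettersAtOneY (xDirMatY)
open Literature.MathematicalPhysics.QuantumFieldTheory.Balaban1983to89.Node00
open Literature.MathematicalPhysics.QuantumFieldTheory.Balaban1983to89.Node00.OpsYCubeDirInverse (indDiagY)
open Literature.MathematicalPhysics.QuantumFieldTheory.Balaban1983to89.Node00.OpsYCubeProjectionG (insideBlkY mem_insideBlkY_iff)
open Literature.MathematicalPhysics.QuantumFieldTheory.Balaban1983to89.B6MultiLevelTorusMirrorBlockTiling (blkInside mem_blkInside blkOf_mem_blkInside_of_mem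
  blkRefl_not_mem_blkInside blkRefl_bot)
open Literature.MathematicalPhysics.QuantumFieldTheory.Balaban1983to89.B6MultiLevelTorusMirrorBlockLetter

/-! ## §1  The two MARGINS of the cube -/

section Margin

variable {d : ℕ} {ℓ Mh k R : ℕ} {P : Fin (d + 1) → ℕ} {D : B6MultiLevelTorusOperator.TDomains d ℓ Mh k P R}
  {hL : Odd (ℓ + 1)} {hM : Odd Mh} {hMh : 1 ≤ Mh} {hP : ∀ μ, 1 ≤ P μ}

/-- ★ g31's MARGIN in the block-tiling shape: a block of the reflected cube family meeting the open box lies in it.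
[cite: Balaban1985BackgroundPropagators, p.408 («Ω₀(□) ⊂ □⁵»); Balaban1983RegularityDecay, (2.42) p.584] -/
theorem hmargC (q : ↥(cubes D.toDomains)) :
    ∀ x ∈ boxC D q, ∀ z : ↥(boxDom (N0 ℓ Mh (kTop q) (Pref ℓ k (kTop q) P (mirC q) (mC q)))),
      blkOf (reflC D q hL hM hMh hP).toDomains z = blkOf (reflC D q hL hM hMh hP).toDomains x → z ∈ boxC D q := by
  intro x hx z hz
  refine margC (hL := hL) (hM := hM) (hMh := hMh) (hP := hP) q x hx z ?_
  have h1 : (reflC D q hL hM hMh hP).lev z.1 = (reflC D q hL hM hMh hP).lev x.1 := by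
    have := congrArg (fun s => s.1.1) hz
    simpa only [blkOf_val, TDomains.toDomains_lev] using this
  have h2 := congrArg (fun s => s.1.2) hz
  simp only [blkOf_val, TDomains.toDomains_lev] at h2
  rw [h1] at h2
  exact h2

/-- ★ **THE MEMBER-SIDE MARGIN**: a block of the cube family `F_□` meeting `Ω₀(□)` lies in `Ω₀(□)` (positive-level sites are in `Ω₀(□) ⊃ C₁(□)`;
a level-0 block is a single site). [cite: Balaban1985BackgroundPropagators, p.408 («Ω₀(□) ⊃ Ω₁(□)»), p.409 l.1–5] -/
theorem mem_dirDomC_of_blkOf_eq (q : ↥(cubes D.toDomains)) {w z : ↥(boxDom (N0 ℓ Mh k P))} (hw : w ∈ dirDomC D q hMh hP)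
    (hz : blkOf (cubeFam D q hL hM hMh hP).toDomains z = blkOf (cubeFam D q hL hM hMh hP).toDomains w) : z ∈ dirDomC D q hMh hP := by
  by_cases hl : 1 ≤ (cubeFam D q hL hM hMh hP).lev z.1
  · exact mem_dirDomC_of_lev_pos hL hM hMh hP q hl
  · have h0 : (cubeFam D q hL hM hMh hP).lev z.1 = 0 := by omega
    have h1 : (cubeFam D q hL hM hMh hP).lev z.1 = (cubeFam D q hL hM hMh hP).lev w.1 := by
      have := congrArg (fun s => s.1.1) hz
      simpa only [blkOf_val, TDomains.toDomains_lev] using this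
    have h2 := congrArg (fun s => s.1.2) hz
    simp only [blkOf_val, TDomains.toDomains_lev, ← h1, h0, pow_zero] at h2
    have hb : ∀ v : Fin (d + 1) → ℤ, blk 1 v = v := fun v => by funext j; simp [blk]
    rw [hb, hb] at h2
    have : z = w := Subtype.ext h2
    rw [this]; exact hw

end Margin

/-! ## §2  The block correspondence `𝔖 ≃ blkInside F′_□ (open box)` at def-Y's index -/

section Corr

variable {d ℓ : ℕ} {hd : 1 ≤ d + 1} {hL : Odd (ℓ + 1) ∧ 1 < ℓ + 1} {b₀ b₁ : ℝ}
variable (i : KIdx d ℓ hd hL b₀ b₁) (q : ↥(cubes (toKT i).D.toDomains))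

/-- **`F′_□`** — the reflected cube family at def-Y's index. [cite: Balaban1983RegularityDecay, (2.42) p.584; Balaban1985BackgroundPropagators, p.408] -/
abbrev reflY : TDomains d ℓ (toKT i).Mh (kTop q) (Pref ℓ (toKT i).k (kTop q) (toKT i).P (mirC q) (mC q)) (toKT i).R :=
  reflC (toKT i).D q hL.1 (oddMh i) (toKT i).hMh (toKT i).hP

/-- the sites of the reflected torus `T′`. [cite: Balaban1983RegularityDecay, (2.39) p.584, dictionary] -/
abbrev SiteRY : Type := ↥(boxDom (N0 ℓ (toKT i).Mh (kTop q) (Pref ℓ (toKT i).k (kTop q) (toKT i).P (mirC q) (mC q))))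

/-- the blocks of `F′_□`. [cite: Balaban1984PropagatorsII, p.231, dictionary] -/
abbrev BlkRY : Type := ↥(bset (reflY i q).toDomains)

/-- the site reflections `σ_ε` of `T′`. [cite: Balaban1983RegularityDecay, (2.40) p.584] -/
abbrev sreflY : (Fin (d + 1) → Bool) → Equiv.Perm (SiteRY i q) :=
  trefl (hmir_of_top (k := (toKT i).k) (k' := kTop q) (P := (toKT i).P) hL.1 (oddMh i) (toKT i).hMh (two_le_mC q))

/-- the block reflections `σ^{blk}_ε` of `F′_□`. [cite: Balaban1984PropagatorsII, (2.45) p.231; Balaban1983RegularityDecay, (2.42) p.584] -/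
abbrev breflY : (Fin (d + 1) → Bool) → Equiv.Perm (BlkRY i q) :=
  blkReflR (cubeFam (toKT i).D q hL.1 (oddMh i) (toKT i).hMh (toKT i).hP) (kTop q) (mirC q) (mC q) (gC q) hL.1 (oddMh i) (toKT i).hMh (toKT i).hP
    (kTop_le q) (lev_cubeFam_le_kTop q) (two_le_mC q) (sTop_dvd_gC q)

/-- `Ĝ := G′[F′_□]` (cube weights). [cite: Balaban1984PropagatorsII, (2.9) p.224; Balaban1985BackgroundPropagators, p.409] -/
abbrev gHatY : Matrix (SiteRY i q) (SiteRY i q) ℝ :=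
  gmlT (N0 ℓ (toKT i).Mh (kTop q) (Pref ℓ (toKT i).k (kTop q) (toKT i).P (mirC q) (mC q))) ℓ (kTop q) (reflY i q).lev (wCube ℓ)

/-- `X̂ := Q′[F′]·Ĝ·Ĝ·Q′*[F′]`. [cite: Balaban1984PropagatorsII, (2.17) p.225] -/
abbrev xHatY : Matrix (BlkRY i q) (BlkRY i q) ℝ :=
  xHat (cubeFam (toKT i).D q hL.1 (oddMh i) (toKT i).hMh (toKT i).hP) (kTop q) (mirC q) (mC q) (gC q) hL.1 (oddMh i) (toKT i).hMh (toKT i).hP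
    (kTop_le q) (lev_cubeFam_le_kTop q) (two_le_mC q) (sTop_dvd_gC q) (wCube ℓ)

/-- `Ĉ := X̂⁻¹` (the genuine torus inverse). [cite: Balaban1984PropagatorsII, (2.17) p.225, Prop. 2.3 p.238] -/
abbrev cHatY : Matrix (BlkRY i q) (BlkRY i q) ℝ :=
  cHat (cubeFam (toKT i).D q hL.1 (oddMh i) (toKT i).hMh (toKT i).hP) (kTop q) (mirC q) (mC q) (gC q) hL.1 (oddMh i) (toKT i).hMh (toKT i).hP
    (kTop_le q) (lev_cubeFam_le_kTop q) (two_le_mC q) (sTop_dvd_gC q) (wCube ℓ)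

/-- the embedding `emb : open box → Ω₀(□)` at def-Y's index (g31 `embC`), as a member site. [cite: Balaban1985BackgroundPropagators, p.408, dictionary] -/
abbrev embY (x : ↥(boxC (toKT i).D q)) : SiteY i := (embC (toKT i).D q (toKT i).hMh (toKT i).hP x).1

/-- ★ a block of `F_□` through a site of `Ω₀(□)` is INSIDE `Ω₀(□)`. [cite: Balaban1985BackgroundPropagators, p.409 l.1–5] -/
theorem blkOf_mem_insideBlkY {w : SiteY i} (hw : w ∈ dirDomY i q) : blkOf (cubeFamY i q).toDomains w ∈ insideBlkY i q (dirDomY i q) :=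
  (mem_insideBlkY_iff i q _ _).2 fun _ hz => mem_dirDomC_of_blkOf_eq (hL := hL.1) (hM := oddMh i) q hw hz

/-- a site of a block inside `Ω₀(□)`, pulled back to the open box (choice). [cite: Balaban1985BackgroundPropagators, p.408, dictionary] -/
def siteIn (s : ↥(insideBlkY i q (dirDomY i q))) : ↥(boxC (toKT i).D q) :=
  (embEquivC (toKT i).D q (toKT i).hMh (toKT i).hP).symm
    ⟨Classical.choose (exists_blkOf_eq (cubeFamY i q).toDomains s.1),
      (mem_insideBlkY_iff i q _ _).1 s.2 _ (Classical.choose_spec (exists_blkOf_eq (cubeFamY i q).toDomains s.1))⟩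

/-- the pulled-back site lies in the block. [cite: Balaban1985BackgroundPropagators, p.408, bookkeeping] -/
theorem blkOf_embY_siteIn (s : ↥(insideBlkY i q (dirDomY i q))) : blkOf (cubeFamY i q).toDomains (embY i q (siteIn i q s)) = s.1 := by
  have h := Classical.choose_spec (exists_blkOf_eq (cubeFamY i q).toDomains s.1)
  have he : embY i q (siteIn i q s) = Classical.choose (exists_blkOf_eq (cubeFamY i q).toDomains s.1) := by
    show ((embEquivC (toKT i).D q (toKT i).hMh (toKT i).hP) ((embEquivC (toKT i).D q (toKT i).hMh (toKT i).hP).symm _)).1 = _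
    rw [Equiv.apply_symm_apply]
  rw [he, h]

/-- ★ **`ŝ`** — the block of `F′_□` corresponding to a block `s` inside `Ω₀(□)`. [cite: Balaban1983RegularityDecay, (2.42) p.584; Balaban1985BackgroundPropagators, p.409 l.1–5] -/
def hatB (s : ↥(insideBlkY i q (dirDomY i q))) : BlkRY i q := blkOf (reflY i q).toDomains (siteIn i q s).1

/-- ★ `y′(ŷ) = ŝ ↔ y(emb ŷ) = s` for `ŷ` in the open box. [cite: Balaban1984PropagatorsII, (2.3) p.224; Balaban1985BackgroundPropagators, p.408] -/
theorem blkOf_eq_hatB_iff (s : ↥(insideBlkY i q (dirDomY i q))) (y : ↥(boxC (toKT i).D q)) :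
    blkOf (reflY i q).toDomains y.1 = hatB i q s ↔ blkOf (cubeFamY i q).toDomains (embY i q y) = s.1 := by
  rw [← blkOf_embY_siteIn i q s]
  exact blkOf_eq_iff_blkOf_emb_eq (F := cubeFam (toKT i).D q hL.1 (oddMh i) (toKT i).hMh (toKT i).hP) (hL := hL.1) (hM := oddMh i) (hMh := (toKT i).hMh)
    (hP := (toKT i).hP) (hk := kTop_le q) (hlev := lev_cubeFam_le_kTop q) (hm := two_le_mC q) (hg := sTop_dvd_gC q) (fitC (toKT i).hMh q)
    (mirBoxOpen_subset_closed y.2) (mirBoxOpen_subset_closed (siteIn i q s).2)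

/-- `ŝ` is INSIDE the open box. [cite: Balaban1985BackgroundPropagators, p.408 («Ω₀(□) ⊂ □⁵»)] -/
theorem hatB_mem (s : ↥(insideBlkY i q (dirDomY i q))) : hatB i q s ∈ blkInside (reflY i q) (boxC (toKT i).D q) :=
  mem_blkInside.2 fun z hz => hmargC (hL := hL.1) (hM := oddMh i) q _ (siteIn i q s).2 z hz

/-- the levels of `ŝ` and `s` agree. [cite: Balaban1984PropagatorsII, (2.3) p.224, bookkeeping] -/
theorem lev_hatB (s : ↥(insideBlkY i q (dirDomY i q))) : (hatB i q s).1.1 = s.1.1.1 := by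
  have h1 : (hatB i q s).1.1 = (reflY i q).lev (siteIn i q s).1.1 := rfl
  have h2 : s.1.1.1 = (cubeFamY i q).lev (embY i q (siteIn i q s)).1 := by
    rw [← blkOf_embY_siteIn i q s]; rfl
  rw [h1, h2, reflected_lev]
  exact levR_of_mem_closed (mirBoxOpen_subset_closed (siteIn i q s).2)

/-- `W[F′](ŝ) = W[F](s)`. [cite: Balaban1984PropagatorsII, (2.69) p.235, bookkeeping] -/
theorem W_hatB (s : ↥(insideBlkY i q (dirDomY i q))) : W (reflY i q).toDomains (hatB i q s) = W (cubeFamY i q).toDomains s.1 := by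
  rw [W_eq, W_eq, lev_hatB]

/-- `hatB` is injective. [cite: Balaban1985BackgroundPropagators, p.408, bookkeeping] -/
theorem hatB_injective : Function.Injective (hatB i q) := by
  intro s t h
  have h1 := (blkOf_eq_hatB_iff i q t (siteIn i q s)).1 (by rw [← h]; rfl)
  rw [blkOf_embY_siteIn] at h1
  exact Subtype.ext h1

/-- `hatB` is surjective onto the blocks inside the open box. [cite: Balaban1985BackgroundPropagators, p.408, bookkeeping] -/
theorem hatB_surjOn (t : BlkRY i q) (ht : t ∈ blkInside (reflY i q) (boxC (toKT i).D q)) : ∃ s, hatB i q s = t := by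
  obtain ⟨y, rfl⟩ := exists_blkOf_eq (reflY i q).toDomains t
  have hy : y ∈ boxC (toKT i).D q := mem_blkInside.1 ht y rfl
  refine ⟨⟨blkOf (cubeFamY i q).toDomains (embY i q ⟨y, hy⟩), blkOf_mem_insideBlkY i q (embC (toKT i).D q (toKT i).hMh (toKT i).hP ⟨y, hy⟩).2⟩, ?_⟩
  exact ((blkOf_eq_hatB_iff i q _ ⟨y, hy⟩).2 rfl).symm

/-- ★ **`𝔖 ≃ blkInside F′_□ (open box)`**. [cite: Balaban1983RegularityDecay, (2.42) p.584; Balaban1985BackgroundPropagators, p.409 l.1–5] -/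
def hatEquiv : ↥(insideBlkY i q (dirDomY i q)) ≃ ↥(blkInside (reflY i q) (boxC (toKT i).D q)) :=
  Equiv.ofBijective (fun s => ⟨hatB i q s, hatB_mem i q s⟩)
    ⟨fun s t h => hatB_injective i q (congrArg Subtype.val h), fun t => by
      obtain ⟨s, hs⟩ := hatB_surjOn i q t.1 t.2
      exact ⟨s, Subtype.ext hs⟩⟩

/-- the value of the equivalence. [cite: Balaban1985BackgroundPropagators, p.409, dictionary] -/
@[simp] theorem hatEquiv_apply (s : ↥(insideBlkY i q (dirDomY i q))) : (hatEquiv i q s).1 = hatB i q s := rfl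

end Corr

/-! ## §3  The three entry identifications on the open box -/

section Ident

variable {d ℓ : ℕ} {hd : 1 ≤ d + 1} {hL : Odd (ℓ + 1) ∧ 1 < ℓ + 1} {b₀ b₁ : ℝ}
variable (i : KIdx d ℓ hd hL b₀ b₁) (q : ↥(cubes (toKT i).D.toDomains))

/-- a member sum of a function vanishing off `Ω₀(□)` is a sum over the open box. [cite: Balaban1985BackgroundPropagators, p.408, bookkeeping] -/
theorem sum_eq_sum_boxC (f : SiteY i → ℝ) (hf : ∀ x, x ∉ dirDomY i q → f x = 0) :
    ∑ x, f x = ∑ x : ↥(boxC (toKT i).D q), f (embY i q x) := by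
  rw [← Finset.sum_subset (Finset.subset_univ (dirDomY i q)) (fun x _ hx => hf x hx), ← Finset.sum_coe_sort]
  exact (Equiv.sum_comp (embEquivC (toKT i).D q (toKT i).hMh (toKT i).hP) (fun v : ↥(dirDomY i q) => f v.1)).symm

/-- ★ (i) `fold(Q′[F′])(ŝ, x̂) = q′_□(s, emb x̂)` — the non-trivial site images of an open-box site are outside the box, hence outside `ŝ`.
[cite: Balaban1983RegularityDecay, (2.42) p.584; Balaban1984PropagatorsII, (2.16) p.225] -/
theorem sfold_QM_hatB (s : ↥(insideBlkY i q (dirDomY i q))) (x : ↥(boxC (toKT i).D q)) :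
    foldK (mirIdx (mirC q)) (sreflY i q) (tsign ℝ (mirC q)) (QM (reflY i q)) (hatB i q s) x.1 = qpKc i q s.1 (embY i q x) := by
  rw [foldK_apply, Finset.sum_eq_single (fun _ => false)]
  · have hb : sreflY i q (fun _ => false) = 1 := trefl_bot _
    rw [tsign_bot, one_mul, hb, Equiv.Perm.coe_one, id]
    show (if blkOf (reflY i q).toDomains x.1 = hatB i q s then (W (reflY i q).toDomains (hatB i q s))⁻¹ else 0) =
      (if blkOf (cubeFamY i q).toDomains (embY i q x) = s.1 then (W (cubeFamY i q).toDomains s.1)⁻¹ else 0)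
    rw [W_hatB]
    exact if_congr (blkOf_eq_hatB_iff i q s x) rfl rfl
  · intro ε hε hne
    have h0 : QM (reflY i q) (hatB i q s) (sreflY i q ε x.1) = 0 := by
      show (if blkOf (reflY i q).toDomains (sreflY i q ε x.1) = hatB i q s then (W (reflY i q).toDomains (hatB i q s))⁻¹ else 0) = 0
      rw [if_neg]
      intro hc
      exact trefl_not_mem_open _ hε hne x.2 (mem_blkInside.1 (hatB_mem i q s) _ hc)
    rw [h0, mul_zero]
  · intro h; exact absurd bot_mem_mirIdx h

/-- ★ (ii) `fold(Ĝ)(x̂, ẑ) = G′_□(1)(emb x̂, emb ẑ)` (g31's site-level method of images). [cite: Balaban1983RegularityDecay, (2.42) p.584; Balaban1985BackgroundPropagators, p.394] -/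
theorem sfold_gHat (x z : ↥(boxC (toKT i).D q)) :
    foldK (mirIdx (mirC q)) (sreflY i q) (tsign ℝ (mirC q)) (gHatY i q) x.1 z.1 = GpDirOneY i q (embY i q x) (embY i q z) := by
  rw [foldK_apply]
  exact (GpDirOne_apply_of_mem (Nat.lt_add_one_iff.mp hL.2) x z).symm

/-- ★ (iii) `fold_blk(Q′*[F′])(ŷ, ŝ′) = q′*_□(emb ŷ, s′)` — the non-trivial block images of `ŝ′` are not inside the box, the block of `ŷ` is.
[cite: Balaban1983RegularityDecay, (2.42) p.584; Balaban1984PropagatorsII, (2.16) p.225] -/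
theorem bfold_QsM_hatB (y : ↥(boxC (toKT i).D q)) (s : ↥(insideBlkY i q (dirDomY i q))) :
    foldK (mirIdx (mirC q)) (breflY i q) (tsign ℝ (mirC q)) (QsM (reflY i q)) y.1 (hatB i q s) = qpsKc i q (embY i q y) s.1 := by
  rw [foldK_apply, Finset.sum_eq_single (fun _ => false)]
  · rw [tsign_bot, one_mul]
    have hb : breflY i q (fun _ => false) = 1 := blkRefl_bot _
    rw [hb, Equiv.Perm.coe_one, id]
    show (if blkOf (reflY i q).toDomains y.1 = hatB i q s then (1 : ℝ) else 0) = (if blkOf (cubeFamY i q).toDomains (embY i q y) = s.1 then (1 : ℝ) else 0)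
    exact if_congr (blkOf_eq_hatB_iff i q s y) rfl rfl
  · intro ε hε hne
    have h0 : QsM (reflY i q) y.1 (breflY i q ε (hatB i q s)) = 0 := by
      show (if blkOf (reflY i q).toDomains y.1 = breflY i q ε (hatB i q s) then (1 : ℝ) else 0) = 0
      rw [if_neg]
      intro hc
      have hin := blkOf_mem_blkInside_of_mem (F := reflY i q) (hmargC (hL := hL.1) (hM := oddMh i) q) y.2
      rw [hc] at hin
      exact blkRefl_not_mem_blkInside (blkOf_trefl_refl (F := cubeFam (toKT i).D q hL.1 (oddMh i) (toKT i).hMh (toKT i).hP) (hL := hL.1) (hM := oddMh i)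
        (hMh := (toKT i).hMh) (hP := (toKT i).hP) (hk := kTop_le q) (hlev := lev_cubeFam_le_kTop q) (hm := two_le_mC q) (hg := sTop_dvd_gC q))
        hε hne (hatB_mem i q s) hin
    rw [h0, mul_zero]
  · intro h; exact absurd bot_mem_mirIdx h

end Ident

/-! ## §4  The entry identity, the explicit `K_X`, and the socket `hKX` DISCHARGED -/

section Socket

variable {d ℓ : ℕ} {hd : 1 ≤ d + 1} {hL : Odd (ℓ + 1) ∧ 1 < ℓ + 1} {b₀ b₁ : ℝ}
variable (i : KIdx d ℓ hd hL b₀ b₁) (q : ↥(cubes (toKT i).D.toDomains))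

/-- `X^{Dir}(1) = q′_□ · G′_□(1) · G′_□(1) · q′*_□` (the compression indicators are idle: `G′_□(1)` vanishes off `Ω₀(□) × Ω₀(□)`).
[cite: Balaban1985BackgroundPropagators, p.409 l.1–5, p.394] -/
theorem xDirMatY_dirDomY_eq : xDirMatY i q (dirDomY i q) (GpDirOneY i q) = qpKc i q * GpDirOneY i q * GpDirOneY i q * qpsKc i q := by
  rw [xDirMatY, compr_GpDirOneY]

/-- ★★ **THE ENTRY IDENTITY**: on the blocks inside `Ω₀(□)`, `X^{Dir}(1)(s, s″) = fold_blk(X̂)(ŝ, ŝ″)` — the U = 1 Dirichlet block word IS the block-level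
signed image sum of the reflected torus word. [cite: Balaban1983RegularityDecay, (2.42) p.584; Balaban1985BackgroundPropagators, p.409 l.1–5; Balaban1984PropagatorsII, (2.17) p.225] -/
theorem xDirMatY_apply_inside (s t : ↥(insideBlkY i q (dirDomY i q))) :
    xDirMatY i q (dirDomY i q) (GpDirOneY i q) s.1 t.1 =
      foldK (mirIdx (mirC q)) (breflY i q) (tsign ℝ (mirC q)) (xHatY i q) (hatB i q s) (hatB i q t) := by
  have hprod := fold_xHat_eq_prod (F := cubeFam (toKT i).D q hL.1 (oddMh i) (toKT i).hMh (toKT i).hP) (hL := hL.1) (hM := oddMh i) (hMh := (toKT i).hMh)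
    (hP := (toKT i).hP) (hk := kTop_le q) (hlev := lev_cubeFam_le_kTop q) (hm := two_le_mC q) (hg := sTop_dvd_gC q) (a := wCube ℓ)
    (wCube_pos (Nat.lt_add_one_iff.mp hL.2)) (blkInside (reflY i q) (boxC (toKT i).D q)) (blkInside (reflY i q) (boxC (toKT i).D q))
  have hent := congr_fun (congr_fun hprod ⟨hatB i q s, hatB_mem i q s⟩) ⟨hatB i q t, hatB_mem i q t⟩
  simp only [Matrix.mul_apply, Matrix.submatrix_apply] at hent
  rw [← hent, xDirMatY_dirDomY_eq]
  simp only [Matrix.mul_apply]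
  -- outer sum over `y`
  rw [sum_eq_sum_boxC i q _ (fun y hy => ?_)]
  swap
  · rw [Finset.sum_eq_zero (fun z _ => ?_), zero_mul]
    rw [show GpDirOneY i q z y = 0 from GpDirOne_apply_of_not_mem_right _ hy, mul_zero]
  refine Finset.sum_congr rfl fun y _ => ?_
  rw [bfold_QsM_hatB]
  congr 1
  -- middle sum over `z`
  rw [sum_eq_sum_boxC i q _ (fun z hz => ?_)]
  swap
  · rw [show GpDirOneY i q z (embY i q y) = 0 from GpDirOne_apply_of_not_mem_left hz _, mul_zero]
  refine Finset.sum_congr rfl fun z _ => ?_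
  rw [sfold_gHat]
  congr 1
  -- inner sum over `x`
  rw [sum_eq_sum_boxC i q _ (fun x hx => ?_)]
  swap
  · rw [show GpDirOneY i q x (embY i q z) = 0 from GpDirOne_apply_of_not_mem_left hx _, mul_zero]
  refine Finset.sum_congr rfl fun x _ => ?_
  rw [sfold_QM_hatB, sfold_gHat]

open Classical in
/-- ★★ **`K_X`** — THE EXPLICIT INVERSE OF THE COMPRESSED U = 1 DIRICHLET BLOCK WORD: on `𝔖 × 𝔖` the block-level signed image sum
`Σ_ε (−1)^{|ε|} Ĉ(ŝ, σ^{blk}_ε ŝ′)` of the genuine torus inverse `Ĉ = (Q′[F′_□]Ĝ²Q′*[F′_□])⁻¹`, zero elsewhere.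
[cite: Balaban1983RegularityDecay, (2.42) p.584; Balaban1985BackgroundPropagators, p.409 l.1–5; Balaban1984PropagatorsII, (2.17) p.225] -/
def kxDirY : Matrix (BlkCubeY i q) (BlkCubeY i q) ℝ := fun s t =>
  if h : s ∈ insideBlkY i q (dirDomY i q) ∧ t ∈ insideBlkY i q (dirDomY i q) then
    foldK (mirIdx (mirC q)) (breflY i q) (tsign ℝ (mirC q)) (cHatY i q) (hatB i q ⟨s, h.1⟩) (hatB i q ⟨t, h.2⟩) else 0

/-- the entries of `K_X` on `𝔖 × 𝔖`. [cite: Balaban1983RegularityDecay, (2.42) p.584, dictionary] -/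
theorem kxDirY_apply_inside (s t : ↥(insideBlkY i q (dirDomY i q))) :
    kxDirY i q s.1 t.1 = foldK (mirIdx (mirC q)) (breflY i q) (tsign ℝ (mirC q)) (cHatY i q) (hatB i q s) (hatB i q t) := by
  unfold kxDirY
  rw [dif_pos ⟨s.2, t.2⟩]

/-- `K_X` vanishes off `𝔖 × 𝔖`. [cite: Balaban1985BackgroundPropagators, p.409 l.1–5, bookkeeping] -/
theorem kxDirY_apply_of_not (s t : BlkCubeY i q) (h : ¬ (s ∈ insideBlkY i q (dirDomY i q) ∧ t ∈ insideBlkY i q (dirDomY i q))) :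
    kxDirY i q s t = 0 := by
  unfold kxDirY
  rw [dif_neg h]

/-- ★★★ **n06-j's SOCKET `hKX` DISCHARGED**: `(xDirMatY i □ Ω₀(□) G′_□(1))|_𝔖 · K_X|_𝔖 = 1` — the compressed U = 1 Dirichlet block word
`(Q′_□G′_□(1)²Q′*_□)|_𝔖` is inverted EXACTLY by the block-level signed image sum of the torus inverse (method of images at block level).
[cite: Balaban1983RegularityDecay, (2.42) p.584; Balaban1985BackgroundPropagators, p.409 l.1–5; Balaban1984PropagatorsII, Prop. 2.3 p.238] -/
theorem hKX_dirDomY :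
    (xDirMatY i q (dirDomY i q) (GpDirOneY i q)).submatrix (fun v : ↥(insideBlkY i q (dirDomY i q)) => (v : BlkCubeY i q))
        (fun v : ↥(insideBlkY i q (dirDomY i q)) => (v : BlkCubeY i q)) *
      (kxDirY i q).submatrix (fun v : ↥(insideBlkY i q (dirDomY i q)) => (v : BlkCubeY i q))
        (fun v : ↥(insideBlkY i q (dirDomY i q)) => (v : BlkCubeY i q)) = 1 := by
  have hone := compress_fold_xHat_mul_compress_fold_cHat (F := cubeFam (toKT i).D q hL.1 (oddMh i) (toKT i).hMh (toKT i).hP) (hL := hL.1) (hM := oddMh i)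
    (hMh := (toKT i).hMh) (hP := (toKT i).hP) (hk := kTop_le q) (hlev := lev_cubeFam_le_kTop q) (hm := two_le_mC q) (hg := sTop_dvd_gC q) (a := wCube ℓ)
    (aplus := 1) (Nat.lt_add_one_iff.mp hL.2) (wCube_pos (Nat.lt_add_one_iff.mp hL.2)) (fun j => (wCube_window (Nat.lt_add_one_iff.mp hL.2) j).2) (hmargC (hL := hL.1) (hM := oddMh i) q)
  have hX : (xDirMatY i q (dirDomY i q) (GpDirOneY i q)).submatrix (fun v : ↥(insideBlkY i q (dirDomY i q)) => (v : BlkCubeY i q))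
        (fun v : ↥(insideBlkY i q (dirDomY i q)) => (v : BlkCubeY i q)) =
      ((foldK (mirIdx (mirC q)) (breflY i q) (tsign ℝ (mirC q)) (xHatY i q)).submatrix
          (fun v : ↥(blkInside (reflY i q) (boxC (toKT i).D q)) => (v : _)) (fun v : ↥(blkInside (reflY i q) (boxC (toKT i).D q)) => (v : _))).submatrix
        (hatEquiv i q) (hatEquiv i q) := by
    ext s t
    simp only [Matrix.submatrix_apply, hatEquiv_apply]
    exact xDirMatY_apply_inside i q s t
  have hK : (kxDirY i q).submatrix (fun v : ↥(insideBlkY i q (dirDomY i q)) => (v : BlkCubeY i q))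
        (fun v : ↥(insideBlkY i q (dirDomY i q)) => (v : BlkCubeY i q)) =
      ((foldK (mirIdx (mirC q)) (breflY i q) (tsign ℝ (mirC q)) (cHatY i q)).submatrix
          (fun v : ↥(blkInside (reflY i q) (boxC (toKT i).D q)) => (v : _)) (fun v : ↥(blkInside (reflY i q) (boxC (toKT i).D q)) => (v : _))).submatrix
        (hatEquiv i q) (hatEquiv i q) := by
    ext s t
    simp only [Matrix.submatrix_apply, hatEquiv_apply]
    exact kxDirY_apply_inside i q s t
  rw [hX, hK, Matrix.submatrix_mul_equiv, hone, Matrix.submatrix_one_equiv]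

end Socket

end

end Literature.MathematicalPhysics.QuantumFieldTheory.Balaban1983to89.B9CubeDirichletCLetterAtOne
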